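import Summits.ResolutionOfSingularities.ResolutionOfSingularities.Theorems.PurelyInseparableDim4IsolationCertRing
import Mathlib.RingTheory.MvPolynomial.Basic
import Mathlib.LinearAlgebra.Dimension.RankNullity
import Mathlib.LinearAlgebra.Dimension.Finite
import Mathlib.LinearAlgebra.FiniteDimensional.Defs
import HarnessLib

/-!
# [OURS · res-dim4-pi PR-10, part 7] STABILISATION = CERTIFICATE: the filtration `J + 𝔪ᴺ` is stationary
  from `N` on iff `𝔪ᴺ ≤ J + 𝔪ᴺ⁺¹`; two consecutive equal colengths `dim_K K[x]/(J_q⁺ + 𝔪₀ᴺ)` certify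
  isolation, and the common value `μ` does not depend on `N ≥ N⁺`

Cell `res-dim4-pi` (D-0157 DOOR 2), PR-10 seventh file (seat `res-dim4-p-3`; CLAIM 17:18Z).  The census
instruments of the ISOLATED regime compute the colength letter `μ` (card I-3-2 / WORD #27 (b): `μ⁺ = μ₂ =`
length of `K[x]_{𝔪₀}/J_q⁺`) as `dim_K K[x]/(J_q⁺(F) + 𝔪₀ᴺ)` and CERTIFY isolation «by stabilisation of
that dimension» (p-12 17:15:10Z, idea-3's `N⁺`).  This file is the kernel form of that protocol, over the
frame's `PIDim4.singLocusIdeal / originIdeal / IsIsolated` and p-3's certificate lemma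
(`isIsolated_of_pow_le_sup_pow_succ`, PR-10) / `certificate_mono` (PR-10 part 6).

## What is proved

* §1 (any commutative ring; ideals `J`, `𝔪`) `sup_pow_succ_eq_iff_certificate`
  (`J ⊔ 𝔪ᴺ⁺¹ = J ⊔ 𝔪ᴺ ↔ 𝔪ᴺ ≤ J ⊔ 𝔪ᴺ⁺¹`) and **`sup_pow_eq_of_certificate`** (then `J ⊔ 𝔪ᴹ = J ⊔ 𝔪ᴺ` for
  every `M ≥ N`: the filtration is STATIONARY from `N` on).
* §2 (the frame, `K` a field, `A = K[x₁..x₄]`) **`moduleFinite_quotient_of_originIdeal_pow_le`**: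
  `𝔪₀ⁿ ≤ I ⇒ A ⧸ I` is a finite-dimensional `K`-space (spanned by the monomials of degree `≤ n`, Mathlib
  `restrictTotalDegree`); `finrank_quotient_eq_of_certificate` (the colength is constant for `N ≥` a
  certificate level: `μ` is well defined).
* §3 **`certificate_of_finrank_eq`**: `finrank_K (A ⧸ (J ⊔ 𝔪₀ᴺ⁺¹)) = finrank_K (A ⧸ (J ⊔ 𝔪₀ᴺ)) ⇒
  𝔪₀ᴺ ≤ J ⊔ 𝔪₀ᴺ⁺¹` (two consecutive equal colengths ⇒ the smaller ideal's image in the bigger quotient has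
  finrank `0`, so the ideals agree), and **`isIsolated_of_finrank_eq`**: with `J_q⁺(F) ≤ 𝔪₀` this certifies
  `IsIsolated q F` — «μ₂ certified by stabilisation» as a theorem.

[OURS · counted 0 · elementary linear/commutative algebra; AI kernel work, weaker than expert review.]
Nothing here is a statement about resolution of singularities; resolution in dimension `≥ 4` /
characteristic `p > 0` is NOT proved by anything in this file.  Host item (DR-157-C):
`stmt-ResolutionOfSingularities-16155`, helper.
-/

noncomputable section

set_option linter.dupNamespace false -- mandated namespace of this single-conjunct summit

open MvPolynomial Finset
open scoped BigOperators

namespace Summit.ResolutionOfSingularities.ResolutionOfSingularities.Theorems.PIDim4.IsolationCert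

/-! ## §1 Stationary filtration ⇔ certificate (any commutative ring) -/

/-- **`J ⊔ 𝔪ᴺ⁺¹ = J ⊔ 𝔪ᴺ ↔ 𝔪ᴺ ≤ J ⊔ 𝔪ᴺ⁺¹`.** OURS (bookkeeping). [cite: AtiyahMacdonald1969, Ch. 1 (operations on ideals)] -/
theorem sup_pow_succ_eq_iff_certificate {A : Type*} [CommRing A] {J m : Ideal A} {N : ℕ} :
    J ⊔ m ^ (N + 1) = J ⊔ m ^ N ↔ m ^ N ≤ J ⊔ m ^ (N + 1) := by
  constructor
  · intro h
    rw [h]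
    exact le_sup_right
  · intro h
    exact le_antisymm (sup_le_sup_left (Ideal.pow_le_pow_right (Nat.le_succ N)) J)
      (sup_le le_sup_left h)

/-- **The filtration `J + 𝔪ᴹ` is stationary from a certificate level on**: `𝔪ᴺ ≤ J ⊔ 𝔪ᴺ⁺¹` and `N ≤ M`
give `J ⊔ 𝔪ᴹ = J ⊔ 𝔪ᴺ`. OURS (bookkeeping; uses `certificate_mono`).
[cite: AtiyahMacdonald1969, Ch. 1 (operations on ideals)] -/
theorem sup_pow_eq_of_certificate {A : Type*} [CommRing A] {J m : Ideal A} {N : ℕ}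
    (h : m ^ N ≤ J ⊔ m ^ (N + 1)) {M : ℕ} (hM : N ≤ M) : J ⊔ m ^ M = J ⊔ m ^ N := by
  obtain ⟨k, rfl⟩ := Nat.exists_eq_add_of_le hM
  induction k with
  | zero => rfl
  | succ k ih =>
    rw [← ih (Nat.le_add_right N k), ← add_assoc]
    exact sup_pow_succ_eq_iff_certificate.mpr (certificate_mono h (Nat.le_add_right N k))

/-! ## §2 Finite-dimensionality of `K[x]/I` for `𝔪₀ⁿ ≤ I`; `μ` is well defined -/

/-- **`𝔪₀ⁿ ≤ I ⇒ K[x₁..x₄]/I` is finite-dimensional over `K`**: the monomials of degree `≤ n` span it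
(the rest lies in `𝔪₀ⁿ⁺¹ ≤ 𝔪₀ⁿ ≤ I`). OURS (elementary; Mathlib `restrictTotalDegree` is finite).
[cite: AtiyahMacdonald1969, Ch. 1 Ex. 1.1 (the ideal (x₁,…,xₙ))] -/
theorem moduleFinite_quotient_of_originIdeal_pow_le {K : Type} [Field K]
    {I : Ideal (MvPolynomial (Fin 4) K)} {n : ℕ} (h : originIdeal K ^ n ≤ I) :
    Module.Finite K (MvPolynomial (Fin 4) K ⧸ I) := by
  classical
  let φ : restrictTotalDegree (Fin 4) K n →ₗ[K] (MvPolynomial (Fin 4) K ⧸ I) :=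
    (Ideal.Quotient.mkₐ K I).toLinearMap.comp (Submodule.subtype _)
  refine Module.Finite.of_surjective φ fun x => ?_
  obtain ⟨f, rfl⟩ := Ideal.Quotient.mkₐ_surjective K I x
  -- split `f` into its part of degree `≤ n` and the rest
  set fl : MvPolynomial (Fin 4) K := ∑ d ∈ f.support with d.degree ≤ n, monomial d (coeff d f)
    with hfl
  set fh : MvPolynomial (Fin 4) K := ∑ d ∈ f.support with ¬ d.degree ≤ n, monomial d (coeff d f)
    with hfh
  have hsplit : fl + fh = f := by
    rw [hfl, hfh, Finset.sum_filter_add_sum_filter_not]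
    exact f.as_sum.symm
  have hlow : fl ∈ restrictTotalDegree (Fin 4) K n := by
    rw [mem_restrictTotalDegree, hfl]
    refine (totalDegree_finsetSum _ _).trans (Finset.sup_le fun d hd => ?_)
    refine (totalDegree_monomial_le _ _).trans ?_
    have := (Finset.mem_filter.mp hd).2
    rw [Finsupp.degree_apply] at this
    exact this
  have hhigh : fh ∈ I := by
    refine h ?_
    rw [originIdeal_eq_idealOfVars, hfh]
    refine Ideal.sum_mem _ fun d hd => ?_
    exact Literature.RingTheory.MvPolynomial.monomial_mem_idealOfVars_pow_of_le
      (by have := (Finset.mem_filter.mp hd).2; omega) _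
  have hzero : Ideal.Quotient.mkₐ K I fh = 0 := by
    rw [Ideal.Quotient.mkₐ_eq_mk]
    exact Ideal.Quotient.eq_zero_iff_mem.mpr hhigh
  refine ⟨⟨fl, hlow⟩, ?_⟩
  change Ideal.Quotient.mkₐ K I fl = Ideal.Quotient.mkₐ K I f
  rw [← hsplit, map_add, hzero, add_zero]

/-- **The colength is constant above a certificate level** (`μ` is well defined): if
`𝔪₀ᴺ ≤ J ⊔ 𝔪₀ᴺ⁺¹` then `finrank_K (A ⧸ (J ⊔ 𝔪₀ᴹ)) = finrank_K (A ⧸ (J ⊔ 𝔪₀ᴺ))` for every `M ≥ N`.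
OURS (bookkeeping). [cite: AtiyahMacdonald1969, Ch. 1 (operations on ideals)] -/
theorem finrank_quotient_eq_of_certificate {K : Type} [Field K] {J : Ideal (MvPolynomial (Fin 4) K)}
    {N : ℕ} (h : originIdeal K ^ N ≤ J ⊔ originIdeal K ^ (N + 1)) {M : ℕ} (hM : N ≤ M) :
    Module.finrank K (MvPolynomial (Fin 4) K ⧸ (J ⊔ originIdeal K ^ M)) =
      Module.finrank K (MvPolynomial (Fin 4) K ⧸ (J ⊔ originIdeal K ^ N)) :=
  (Ideal.quotientEquivAlgOfEq K (sup_pow_eq_of_certificate h hM)).toLinearEquiv.finrank_eq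

/-! ## §3 Two consecutive equal colengths certify isolation -/

/-- **Equal consecutive colengths ⇒ certificate.** If `finrank_K (A ⧸ (J ⊔ 𝔪₀ᴺ⁺¹)) = finrank_K (A ⧸ (J ⊔ 𝔪₀ᴺ))`
then `𝔪₀ᴺ ≤ J ⊔ 𝔪₀ᴺ⁺¹`: in the finite-dimensional `A ⧸ (J ⊔ 𝔪₀ᴺ⁺¹)` the image of `J ⊔ 𝔪₀ᴺ` has
finrank `0` (rank–nullity against the double quotient `≅ A ⧸ (J ⊔ 𝔪₀ᴺ)`), hence is `⊥`. OURS (elementary).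
[cite: AtiyahMacdonald1969, Prop. 6.9 (length is additive)] -/
theorem certificate_of_finrank_eq {K : Type} [Field K] {J : Ideal (MvPolynomial (Fin 4) K)} {N : ℕ}
    (h : Module.finrank K (MvPolynomial (Fin 4) K ⧸ (J ⊔ originIdeal K ^ (N + 1))) =
      Module.finrank K (MvPolynomial (Fin 4) K ⧸ (J ⊔ originIdeal K ^ N))) :
    originIdeal K ^ N ≤ J ⊔ originIdeal K ^ (N + 1) := by
  set I : Ideal (MvPolynomial (Fin 4) K) := J ⊔ originIdeal K ^ (N + 1) with hI
  set I' : Ideal (MvPolynomial (Fin 4) K) := J ⊔ originIdeal K ^ N with hI'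
  have hle : I ≤ I' := sup_le_sup_left (Ideal.pow_le_pow_right (Nat.le_succ N)) J
  haveI : Module.Finite K (MvPolynomial (Fin 4) K ⧸ I) :=
    moduleFinite_quotient_of_originIdeal_pow_le (n := N + 1) le_sup_right
  -- the image of `I'` in `A ⧸ I` and the double quotient
  set W : Ideal (MvPolynomial (Fin 4) K ⧸ I) := I'.map (Ideal.Quotient.mkₐ K I) with hW
  have hquot : Module.finrank K ((MvPolynomial (Fin 4) K ⧸ I) ⧸ W) =
      Module.finrank K (MvPolynomial (Fin 4) K ⧸ I') :=
    (DoubleQuot.quotQuotEquivQuotOfLEₐ K hle).toLinearEquiv.finrank_eq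
  have hrank := Submodule.finrank_quotient (R := K) W
  rw [hquot, ← h] at hrank
  have hWle : Module.finrank K W ≤ Module.finrank K (MvPolynomial (Fin 4) K ⧸ I) :=
    Submodule.finrank_le (W.restrictScalars K)
  have hW0 : Module.finrank K (W.restrictScalars K) = 0 := by
    change Module.finrank K W = 0
    omega
  have hWbot : W = ⊥ := by
    have := (Submodule.finrank_eq_zero (R := K) (S := W.restrictScalars K)).mp hW0
    rwa [Submodule.restrictScalars_eq_bot_iff] at this
  -- `W = ⊥` means `I' ≤ I`
  have hI'I : I' ≤ I := fun x hx => by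
    have hx' := (Ideal.map_eq_bot_iff_le_ker (Ideal.Quotient.mkₐ K I)).mp hWbot hx
    rw [RingHom.mem_ker] at hx'
    change Ideal.Quotient.mkₐ K I x = 0 at hx'
    rw [Ideal.Quotient.mkₐ_eq_mk] at hx'
    exact Ideal.Quotient.eq_zero_iff_mem.mp hx'
  exact le_sup_right.trans hI'I

/-- **«μ₂ certified by stabilisation» as a theorem**: if `J_q⁺(F) ≤ 𝔪₀` and two consecutive colengths
`dim_K K[x]/(J_q⁺(F) + 𝔪₀ᴺ⁺¹) = dim_K K[x]/(J_q⁺(F) + 𝔪₀ᴺ)` agree, then the origin is an ISOLATED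
`q`-fold point (and the common value is the letter `μ` at every `M ≥ N`, `finrank_quotient_eq_of_certificate`).
OURS (elementary). [cite: AtiyahMacdonald1969, Prop. 2.6 / Cor. 2.7 (Nakayama's lemma)] -/
theorem isIsolated_of_finrank_eq {K : Type} [Field K] {q : ℕ} {F : MvPolynomial (Fin 4) K}
    (hJ : singLocusIdeal q F ≤ originIdeal K) {N : ℕ}
    (h : Module.finrank K (MvPolynomial (Fin 4) K ⧸ (singLocusIdeal q F ⊔ originIdeal K ^ (N + 1))) =
      Module.finrank K (MvPolynomial (Fin 4) K ⧸ (singLocusIdeal q F ⊔ originIdeal K ^ N))) :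
    IsIsolated q F :=
  isIsolated_of_pow_le_sup_pow_succ hJ (certificate_of_finrank_eq h)

end Summit.ResolutionOfSingularities.ResolutionOfSingularities.Theorems.PIDim4.IsolationCert

end
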